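import Literature.Computability.MetaComplexity.SliceLowerBoundNP
import Literature.Computability.MetaComplexity.ParamUniformHeuristics
import Mathlib.Analysis.SpecificLimits.Normed
import HarnessLib

/-!
# Complexity meta: the slice-size estimator of Hirahara 2021, Lemma 4.5 (test `R₂`, promise problem, estimator `M`)

Topic `Literature/Computability/MetaComplexity`, the inline Lemma 4.5 of the proof plan of
`Hirahara2021_languageCompression` (S. Hirahara, ECCC TR21-058 (2021), Lemma 4.5, p. 26, proof
pp. 27–28), in three parts.

**Part 1 — the randomised test `R₂`** (p. 28: "a randomized algorithm `R₂` … takes `(1ᵗ, 1ᵏ)` as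
input and checks whether `D₂(r, 1^{⟨t,k⟩}) = 1` … If `|L_t| ≥ 2ᵏ` we have `Pr_r[D₂ = 1] ≥ 1 - 2^{-t}`
… if `|L_t| ≤ 2^{k-1}` then `Pr_r[D₂ = 0] ≥ δ(ℓ(t)) - 2^{-t} ≥ δ(ℓ(t))/2`"), where `D₂` is the
errorless one-sided heuristic of Lemma 3.6 for the lower-bound language `L'` (`SLB.gsLang`,
`SliceLowerBoundNP.lean`):

* `SLB.gF pL` — the `FP` map `⟨⟨1ᵗ, 1^κ⟩, z⟩ ↦ (z ↾ ℓ(t,κ), 1^{⟨t,κ⟩})`, `ℓ(t,κ) = u(t)B(t,κ)`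
  (`gF_boolPair`, `gF_mem_FP`), and the rejection event `SLB.rejLang D₀ pL = gF⁻¹(D₀ᶜ) ∈ P`;
* per-block probabilities over `z ∈ {0,1}^N`, `N ≥ ℓ(t,κ)` (only the prefix matters,
  `ParamUniform.uniformProb_setOf_take`): `uniformProb_rej_le` (`|L_t| ≥ 2^κ`, `D₀ ⊇ L'`:
  `Pr[reject] ≤ e^{-(t+1)}`) and `uniformProb_rej_ge` (`2|L_t| ≤ 2^κ`, `D₀` correct on `L'` with
  probability `≥ 1/q`: `Pr[reject] ≥ 1/q - e^{-(t+1)}`);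
* the block disjunction's exact acceptance probability `uniformProb_blockOr_eq`
  (`1 - (1 - Pr[A])^K`, from `CoinBlocks.cnt_allBlocks_eq_pow`) with the two consequences used to
  place the promise problem in `PromiseBPP'`: `uniformProb_blockOr_le_mul` (`≤ K · Pr[A]`) and
  `uniformProb_blockOr_ge_34` (`Pr[A] ≥ 1/(n+1)`, `K = 2(n+1)` ⇒ `≥ 3/4`).

**Part 2 — the promise problem is in promise-`BPP`, hence in `P`.** Under the hypothesis
`coNP × {U, T} ⊆ Avg¹_{1-n^{-c}}P` (through `D₂`, `ParamUniform.exists_heuristic_paramUniform` +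
`SLB.gsLang_mem_NP`) and `pr-BPP = pr-P`, the promise problem

  `Π_yes = {(1ᵗ, 1^κ) : |L_t| ≥ 2^κ}`, `Π_no = {(1ᵗ, 1^κ) : 2|L_t| ≤ 2^κ}` (`t ≥ T₀`, `κ ≤ p_L(t) + 2`)

is solved by the randomised test "`D₂` rejects one of `K` independent samples `(r, 1^{⟨t,κ⟩})`"
(`SLB.estProblem_mem_PromiseBPP'`: yes-instances are rejected with probability `≤ K e^{-(t+1)} ≤ 1/4`,
no-instances with probability `≥ 3/4`, for `t ≥ T₀` where `T₀` absorbs the polynomial factors against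
`2^t`), hence by `pr-BPP = pr-P` by a language `S ∈ P` (`SLB.exists_sliceTest`); bookkeeping:
`SLB.exists_mul_pow_le_two_pow`, `SLB.exists_eval_le_two_pow` (polynomials are eventually `≤ 2ᵗ`),
`SLB.blockPoly`, `SLB.sizePoly` (the coin block length and `ℓ(t,κ) + ⟨t,κ⟩ ≤ sizePoly(|x|)`).

**Part 3 — the estimator `M`** (p. 28: "one can compute the maximum `k* ∈ ℕ` [accepted on]
`(1ᵗ, 1ᵏ)`. The output of `M` is defined to be `k*`."): given the test `S ∈ P`, the `FP` function
`SLB.estF` runs `κ = 0, …, p_L(t) + 2` and outputs `1^{κ*}`, `κ* = 1 + max{κ accepted}` (`0` if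
none); then `|L_t| ≤ 2^{κ*}` and `κ* ≤ log₂|L_t| + 3` for `t ≥ T₀` (`SLB.estF_spec`), and
**`SLB.exists_logSizeEstimator`** is Lemma 4.5 in the form of hypothesis `h45` of
`LCAssembly.Hirahara2021_languageCompression_of_lemmas`, under the hypothesis of Theorem 4.2 and
`pr-BPP = pr-P` (the printed `|L_t| ≤ s(t) ≤ 4|L_t|` with `s = 2^{κ*}` up to the rounding
conventions recorded there).

## References

* S. Hirahara, ECCC TR21-058 (2021), Lemma 4.5 and its proof (pp. 26–28) [Hirahara2021].
* S. Arora, B. Barak, *Computational Complexity: A Modern Approach*, CUP 2009, §7.4.1 (error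
  reduction), Def. 7.3, §1.3 (polynomial-time plumbing, bounded loops) [AroraBarakCC2009];
  O. Goldreich, *On promise problems: a survey*, 2006, Def. 1.2 [GoldreichPromise2006].
-/

noncomputable section

/-! ## Part 1 — the randomised slice-size test `R₂` -/

namespace Literature.Computability.MetaComplexity

open _root_.Computability Polynomial Complexity Complexity.Classes Complexity.Brick Complexity.Plumb
  Complexity.HashBricks Finset Real

namespace SLB

open scoped Classical

/-! ### The block disjunction: exact acceptance probability -/

section BlockOr

open Complexity.CoinBlocks

variable (A : Language Bool) (p r : Polynomial ℕ) (x : List Bool)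

/-- **Exact acceptance probability of the block disjunction**: `1 - (1 - Pr[A])^K`, `K = r(|x|)+1`
(the rejecting coin strings are those all of whose blocks reject, `cnt_allBlocks_eq_pow`).
[cite: AroraBarakCC2009, §7.4.1] -/
theorem uniformProb_blockOr_eq :
    uniformProb ((r.eval x.length + 1) * p.eval x.length) {y | boolPair x y ∈ blockOr A p (r + 1)} =
      1 - (1 - uniformProb (p.eval x.length) {z | boolPair x z ∈ A}) ^ (r.eval x.length + 1) := by
  set ℓ := p.eval x.length with hℓ
  set K := r.eval x.length + 1 with hK
  set G : Set (List Bool) := {z | boolPair x z ∈ A} with hG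
  set E : Set (List Bool) := {y | boolPair x y ∈ blockOr A p (r + 1)} with hE
  have hcompl : Eᶜ = allBlocks ℓ K Gᶜ := by
    rw [hE, compl_setOf_mem_blockOr]
    rfl
  have hcnt : cnt (K * ℓ) Eᶜ = cnt ℓ Gᶜ ^ K := by rw [hcompl, cnt_allBlocks_eq_pow]
  have hbad : uniformProb (K * ℓ) Eᶜ = (uniformProb ℓ Gᶜ) ^ K := by
    rw [uniformProb_eq_cnt_div, uniformProb_eq_cnt_div, hcnt, div_pow, ← pow_mul, mul_comm ℓ K]
    push_cast
    rfl
  rw [show uniformProb (K * ℓ) E = 1 - uniformProb (K * ℓ) Eᶜ by rw [uniformProb_compl]; ring, hbad, uniformProb_compl]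

/-- **Union-bound side**: `Pr[block disjunction] ≤ K · Pr[A]` (Bernoulli's inequality). [cite: AroraBarakCC2009, §7.4.1] -/
theorem uniformProb_blockOr_le_mul :
    uniformProb ((r.eval x.length + 1) * p.eval x.length) {y | boolPair x y ∈ blockOr A p (r + 1)} ≤
      (r.eval x.length + 1 : ℕ) * uniformProb (p.eval x.length) {z | boolPair x z ∈ A} := by
  rw [uniformProb_blockOr_eq]
  set g := uniformProb (p.eval x.length) {z | boolPair x z ∈ A}
  have hg0 : 0 ≤ g := uniformProb_nonneg _ _
  have hg1 : g ≤ 1 := uniformProb_le_one _ _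
  have hb := one_add_mul_le_pow (show (-2 : ℝ) ≤ -g by linarith) (r.eval x.length + 1)
  rw [mul_neg, ← sub_eq_add_neg, ← sub_eq_add_neg] at hb
  push_cast at hb ⊢
  linarith

/-- **Boosting side**: if `Pr[A] ≥ 1/(n(|x|)+1)` then the block disjunction over `K = 2(n(|x|)+1)`
blocks accepts with probability `≥ 3/4` (`(1 - 1/(n+1))^{2(n+1)} ≤ 1/4`). [cite: AroraBarakCC2009, §7.4.1 (error reduction for RP)] -/
theorem uniformProb_blockOr_ge_34 (n : Polynomial ℕ)
    (h : 1 / (((n.eval x.length : ℕ) : ℝ) + 1) ≤ uniformProb (p.eval x.length) {z | boolPair x z ∈ A}) :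
    3 / 4 ≤ uniformProb (((2 * n + 1 : Polynomial ℕ).eval x.length + 1) * p.eval x.length)
      {y | boolPair x y ∈ blockOr A p (2 * n + 1 + 1)} := by
  rw [uniformProb_blockOr_eq]
  set g := uniformProb (p.eval x.length) {z | boolPair x z ∈ A}
  set m := n.eval x.length + 1 with hm
  have hK : (2 * n + 1 : Polynomial ℕ).eval x.length + 1 = 2 * m := by simp [hm]; ring
  have hg1 : g ≤ 1 := uniformProb_le_one _ _
  have hm1 : 1 ≤ m := by omega
  have hmr : 1 / (m : ℝ) ≤ g := by simpa [hm] using h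
  have hpow : (1 - g) ^ (2 * m) ≤ 1 / 4 := by
    calc (1 - g) ^ (2 * m) ≤ (1 - 1 / (m : ℝ)) ^ (2 * m) :=
          pow_le_pow_left₀ (by linarith) (by linarith) _
      _ = ((1 - 1 / (m : ℝ)) ^ m) ^ 2 := by rw [← pow_mul, mul_comm]
      _ ≤ (1 / 2) ^ 2 := pow_le_pow_left₀ (pow_nonneg (by
          have : (1 : ℝ) ≤ m := by exact_mod_cast hm1
          have : 1 / (m : ℝ) ≤ 1 := by rw [div_le_one (by positivity)]; exact this
          linarith) _) (one_sub_inv_pow_le_half hm1) 2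
      _ = 1 / 4 := by norm_num
  rw [hK]
  linarith

end BlockOr

/-! ### The instance map and the rejection event -/

section Map

variable (pL : Polynomial ℕ)

/-- Sample length `ℓ(t, κ) = u(t) · B(t, κ)`. [folklore] -/
def ellLen (t κ : ℕ) : ℕ := tests t * blkLen pL t κ

/-- `1ᵗ` of `w = ⟨⟨1ᵗ, 1^κ⟩, z⟩`. [folklore] -/
def tX : List Bool → List Bool := onesFn ∘ fstF ∘ fstF
/-- `1^κ`. [folklore] -/
def kX : List Bool → List Bool := onesFn ∘ sndF ∘ fstF
/-- `1^{ℓ(t,κ)}`. [folklore] -/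
def ellU : List Bool → List Bool :=
  umulFn ∘ fanoutFn (polyFn (128 * (X + 1)) ∘ tX)
    (umulFn ∘ fanoutFn (List.cons true ∘ kX) (List.cons true ∘ List.cons true ∘ polyFn pL ∘ tX))

/-- **The instance map** `⟨⟨1ᵗ, 1^κ⟩, z⟩ ↦ (z ↾ ℓ(t,κ), 1^{⟨t,κ⟩})`. [cite: Hirahara2021, Lemma 4.5 (proof: "picks r ∼ {0,1}^{ℓ(t)} … D₂(r, 1^{⟨t,k⟩})")] -/
def gF : List Bool → List Bool := fanoutFn (takeFn ∘ fanoutFn (ellU pL) sndF) (pairUF ∘ fanoutFn tX kX)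

/-- Value of the instance map. [folklore] -/
theorem gF_boolPair (t κ : ℕ) (z : List Bool) :
    gF pL (boolPair (boolPair (ones t) (ones κ)) z) = paramEnc (z.take (ellLen pL t κ), Nat.pair t κ) := by
  have ht : tX (boolPair (boolPair (ones t) (ones κ)) z) = ones t := by simp [tX, onesFn, ParamUniform.unaryEncodeNat_eq_ones]
  have hk : kX (boolPair (boolPair (ones t) (ones κ)) z) = ones κ := by simp [kX, onesFn, ParamUniform.unaryEncodeNat_eq_ones]
  have hℓ : ellU pL (boolPair (boolPair (ones t) (ones κ)) z) = ones (ellLen pL t κ) := by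
    simp only [ellU, Function.comp_apply, fanoutFn_apply, ht, hk, polyFn_apply, ParamUniform.length_ones]
    rw [show true :: ones κ = ones (κ + 1) by simp [ones, List.replicate_succ],
      show true :: true :: ones (pL.eval t) = ones (memLen pL t + 1) by simp [ones, memLen, List.replicate_succ],
      umulFn_boolPair, umulFn_boolPair]
    simp [ellLen, tests, blkLen]
  rw [gF, fanoutFn_apply, Function.comp_apply, fanoutFn_apply, hℓ, sndF_boolPair, takeFn_boolPair, ParamUniform.length_ones,
    Function.comp_apply, fanoutFn_apply, ht, hk, pairUF_boolPair, paramEnc, ParamUniform.unaryEncodeNat_eq_ones]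

/-- The instance map is in `FP`. [cite: AroraBarakCC2009, §1.3] -/
theorem gF_mem_FP : gF pL ∈ FP := by
  have ht : tX ∈ FP := comp_mem_FP onesFn_mem_FP (comp_mem_FP fstF_mem_FP fstF_mem_FP)
  have hk : kX ∈ FP := comp_mem_FP onesFn_mem_FP (comp_mem_FP sndF_mem_FP fstF_mem_FP)
  have hℓ : ellU pL ∈ FP := comp_mem_FP umulFn_mem_FP (fanoutFn_mem_FP (comp_mem_FP (polyFn_mem_FP _) ht)
    (comp_mem_FP umulFn_mem_FP (fanoutFn_mem_FP (comp_mem_FP (cons_mem_FP true) hk)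
      (comp_mem_FP (cons_mem_FP true) (comp_mem_FP (cons_mem_FP true) (comp_mem_FP (polyFn_mem_FP pL) ht))))))
  exact fanoutFn_mem_FP (comp_mem_FP takeFn_mem_FP (fanoutFn_mem_FP hℓ sndF_mem_FP))
    (comp_mem_FP pairUF_mem_FP (fanoutFn_mem_FP ht hk))

variable (D₀ : Language Bool)

/-- **The rejection event** `A = gF⁻¹(D₀ᶜ)`: "`D₂` rejects `(z ↾ ℓ, 1^{⟨t,κ⟩})`". [cite: Hirahara2021, Lemma 4.5 (proof, algorithm R₂)] -/
def rejLang : Language Bool := gF pL ⁻¹' D₀ᶜ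

/-- The rejection event is in `P` when `D₀` is. [cite: AroraBarakCC2009, §1.3] -/
theorem rejLang_mem_P (hD₀ : D₀ ∈ Classes.P) : rejLang pL D₀ ∈ Classes.P :=
  preimage_mem_P (compl_mem_P_iff.2 hD₀) (gF_mem_FP pL)

/-- Membership in the rejection event. [folklore] -/
theorem mem_rejLang_iff (t κ : ℕ) (z : List Bool) :
    boolPair (boolPair (ones t) (ones κ)) z ∈ rejLang pL D₀ ↔ paramEnc (z.take (ellLen pL t κ), Nat.pair t κ) ∉ D₀ := by
  change gF pL (boolPair (boolPair (ones t) (ones κ)) z) ∈ D₀ᶜ ↔ _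
  rw [gF_boolPair]
  rfl

end Map

/-! ### Per-block probabilities -/

section Prob

variable {L D₀ : Language Bool} {pL : Polynomial ℕ} {t κ N : ℕ}

/-- **Yes side** (`|L_t| ≥ 2^κ`): if `D₀` accepts every member of `L'`, a uniformly random block
`z ∈ {0,1}^N` (`N ≥ ℓ(t,κ)`) is rejected with probability `≤ e^{-(t+1)}`. [cite: Hirahara2021, Lemma 4.5 (proof: "Pr[D₂ = 1] ≥ Pr[(r,1^{⟨t,k⟩}) ∈ L'] ≥ 1 - 2^{-t}")] -/
theorem uniformProb_rej_le (hP : ∀ x ∈ languageSlice L t, x.length ≤ pL.eval t)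
    (hκ : 2 ^ κ ≤ (languageSlice L t).ncard)
    (hmem : ∀ (m : ℕ) (r : List Bool), paramEnc (r, m) ∈ gsLang L pL → paramEnc (r, m) ∈ D₀) (hN : ellLen pL t κ ≤ N) :
    uniformProb N {z | boolPair (boolPair (ones t) (ones κ)) z ∈ rejLang pL D₀} ≤ exp (-((t : ℝ) + 1)) := by
  obtain ⟨d, rfl⟩ := Nat.exists_eq_add_of_le hN
  have hsub : uniformProb (ellLen pL t κ + d) {z | boolPair (boolPair (ones t) (ones κ)) z ∈ rejLang pL D₀} ≤
      uniformProb (ellLen pL t κ + d) {z | z.take (ellLen pL t κ) ∈ {r | paramEnc (r, Nat.pair t κ) ∉ gsLang L pL}} := by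
    refine ParamUniform.uniformProb_mono' fun z _ hz => ?_
    simp only [Set.mem_setOf_eq, mem_rejLang_iff] at hz ⊢
    exact fun h => hz (hmem _ _ h)
  refine hsub.trans ?_
  rw [ParamUniform.uniformProb_setOf_take]
  exact uniformProb_not_gsLang_le hP hκ

/-- **No side** (`2|L_t| ≤ 2^κ`): if `D₀` agrees with `L'` on a `≥ 1/q` fraction of the samples of
length `ℓ(t,κ)`, a uniformly random block `z ∈ {0,1}^N` (`N ≥ ℓ(t,κ)`) is rejected with probability
`≥ 1/q - e^{-(t+1)}`. [cite: Hirahara2021, Lemma 4.5 (proof: "Pr[D₂ = 0] ≥ δ(ℓ(t)) - 2^{-t}")] -/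
theorem uniformProb_rej_ge (hP : ∀ x ∈ languageSlice L t, x.length ≤ pL.eval t)
    (hκ : 2 * (languageSlice L t).ncard ≤ 2 ^ κ) {q : ℝ}
    (hcorr : 1 / q ≤ uniformProb (ellLen pL t κ)
      {r | paramEnc (r, Nat.pair t κ) ∈ D₀ ↔ paramEnc (r, Nat.pair t κ) ∈ gsLang L pL}) (hN : ellLen pL t κ ≤ N) :
    1 / q - exp (-((t : ℝ) + 1)) ≤ uniformProb N {z | boolPair (boolPair (ones t) (ones κ)) z ∈ rejLang pL D₀} := by
  obtain ⟨d, rfl⟩ := Nat.exists_eq_add_of_le hN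
  set ℓ := ellLen pL t κ with hℓ
  -- on samples of length `ℓ`: correct ⊆ reject ∪ member
  have hstep : uniformProb ℓ {r | paramEnc (r, Nat.pair t κ) ∈ D₀ ↔ paramEnc (r, Nat.pair t κ) ∈ gsLang L pL} ≤
      uniformProb ℓ {r | paramEnc (r, Nat.pair t κ) ∉ D₀} + uniformProb ℓ {r | paramEnc (r, Nat.pair t κ) ∈ gsLang L pL} := by
    refine le_trans (ParamUniform.uniformProb_mono' fun r _ hr => ?_) (uniformProb_union_le ℓ _ _)
    simp only [Set.mem_setOf_eq, Set.mem_union] at hr ⊢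
    by_cases h : paramEnc (r, Nat.pair t κ) ∈ D₀
    · exact Or.inr (hr.1 h)
    · exact Or.inl h
  have hmem : uniformProb ℓ {r | paramEnc (r, Nat.pair t κ) ∈ gsLang L pL} ≤ exp (-((t : ℝ) + 1)) :=
    uniformProb_gsLang_le (pL := pL) (κ := κ) hP hκ
  have hrej : uniformProb ℓ {r | paramEnc (r, Nat.pair t κ) ∉ D₀} =
      uniformProb (ℓ + d) {z | boolPair (boolPair (ones t) (ones κ)) z ∈ rejLang pL D₀} := by
    rw [← ParamUniform.uniformProb_setOf_take ℓ d]
    refine ParamUniform.uniformProb_congr' fun z _ => ?_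
    simp only [Set.mem_setOf_eq, mem_rejLang_iff, hℓ]
  rw [← hrej]
  linarith

end Prob

end SLB

end Literature.Computability.MetaComplexity

/-! ## Part 2 — the slice-size promise problem is in promise-`BPP` (hence in `P`) -/

namespace Literature.Computability.MetaComplexity

open _root_.Computability Polynomial Complexity Complexity.Classes Complexity.Nondeterministic
  Complexity.Brick Complexity.CoinBlocks Finset Real Filter

namespace SLB

open scoped Classical

/-! ### Polynomials against `2ᵗ` -/

/-- `c · nᵈ ≤ 2ⁿ` for all large `n`. [folklore] -/
theorem exists_mul_pow_le_two_pow (c d : ℕ) : ∃ N : ℕ, ∀ n : ℕ, N ≤ n → c * n ^ d ≤ 2 ^ n := by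
  have ht := tendsto_pow_const_div_const_pow_of_one_lt d (one_lt_two (α := ℝ))
  have hev : ∀ᶠ n : ℕ in atTop, (n : ℝ) ^ d / 2 ^ n ≤ 1 / ((c : ℝ) + 1) :=
    ht.eventually (ge_mem_nhds (by positivity))
  obtain ⟨N, hN⟩ := eventually_atTop.1 hev
  refine ⟨N, fun n hn => ?_⟩
  have h := hN n hn
  rw [div_le_div_iff₀ (by positivity) (by positivity), one_mul] at h
  have h' : ((c : ℝ) + 1) * (n : ℝ) ^ d ≤ 2 ^ n := by linarith
  have h'' : (c : ℝ) * (n : ℝ) ^ d ≤ 2 ^ n := by nlinarith [pow_nonneg (Nat.cast_nonneg n : (0 : ℝ) ≤ n) d]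
  exact_mod_cast h''

/-- **A polynomial is eventually below `2ᵗ`**, with room for a constant factor: `c · Q(t) ≤ 2ᵗ` for
`t ≥ T`. [folklore] -/
theorem exists_eval_le_two_pow (c : ℕ) (Q : Polynomial ℕ) : ∃ T : ℕ, ∀ t : ℕ, T ≤ t → c * Q.eval t ≤ 2 ^ t := by
  obtain ⟨c₁, d, hQ⟩ := LCBounds.exists_eval_le_mul_pow Q
  obtain ⟨N, hN⟩ := exists_mul_pow_le_two_pow (4 * (c * c₁)) d
  refine ⟨N, fun t ht => ?_⟩
  have h := hN (t + 2) (by omega)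
  rw [pow_add] at h
  have h2 : c * Q.eval t ≤ c * (c₁ * (t + 2) ^ d) := Nat.mul_le_mul_left _ (hQ t)
  nlinarith

/-- `2ᵗ ≤ e^{t+1}`, so `e^{-(t+1)} ≤ 2^{-t}`. [folklore] -/
theorem exp_neg_le_inv_two_pow (t : ℕ) : exp (-((t : ℝ) + 1)) ≤ 1 / 2 ^ t := by
  rw [exp_neg, ← one_div, one_div_le_one_div (exp_pos _) (by positivity)]
  have h2 : (2 : ℝ) ≤ exp 1 := by have := add_one_le_exp (1 : ℝ); norm_num at this ⊢; linarith
  calc (2 : ℝ) ^ t ≤ (exp 1) ^ t := pow_le_pow_left₀ (by norm_num) h2 t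
    _ = exp t := by rw [← exp_one_pow]
    _ ≤ exp ((t : ℝ) + 1) := exp_le_exp.2 (by linarith)

/-! ### The polynomial bookkeeping -/

section Polys

variable (pL : Polynomial ℕ)

/-- Coin block length `128(|x|+1)·(|x|+1)·(p_L(|x|)+2) ≥ ℓ(t,κ)`. [folklore] -/
def blockPoly : Polynomial ℕ := 128 * (X + 1) * ((X + 1) * (pL + 2))

/-- A bound for `ℓ(t,κ) + ⟨t,κ⟩` in terms of `|x|`. [folklore] -/
def sizePoly : Polynomial ℕ := blockPoly pL + (X + 1) * (X + 1)

/-- The length of the instance `x = ⟨1ᵗ, 1^κ⟩`. [folklore] -/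
theorem length_inst (t κ : ℕ) : (boolPair (ones t) (ones κ)).length = 2 * t + 2 + κ := by
  simp [length_boolPair]

/-- `ℓ(t,κ) ≤ blockPoly(|x|)`. [folklore] -/
theorem ellLen_le_blockPoly (t κ : ℕ) : ellLen pL t κ ≤ (blockPoly pL).eval (boolPair (ones t) (ones κ)).length := by
  rw [length_inst]
  have hP : pL.eval t ≤ pL.eval (2 * t + 2 + κ) := LCBounds.eval_mono pL (by omega)
  have hev : (blockPoly pL).eval (2 * t + 2 + κ) = 128 * (2 * t + 2 + κ + 1) * ((2 * t + 2 + κ + 1) * (pL.eval (2 * t + 2 + κ) + 2)) := by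
    simp [blockPoly]
  rw [hev, ellLen, tests, blkLen, memLen]
  exact Nat.mul_le_mul (Nat.mul_le_mul_left _ (by omega)) (Nat.mul_le_mul (by omega) (by omega))

/-- `ℓ(t,κ) + ⟨t,κ⟩ ≤ sizePoly(|x|)`. [folklore] -/
theorem size_le_sizePoly (t κ : ℕ) :
    ellLen pL t κ + Nat.pair t κ ≤ (sizePoly pL).eval (boolPair (ones t) (ones κ)).length := by
  have h1 := ellLen_le_blockPoly pL t κ
  rw [length_inst] at h1
  rw [sizePoly, eval_add, eval_mul, eval_add, eval_X, eval_one, length_inst]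
  have hp : Nat.pair t κ < (max t κ + 1) ^ 2 := Nat.pair_lt_max_add_one_sq t κ
  rw [pow_two] at hp
  have hm : max t κ + 1 ≤ 2 * t + 2 + κ + 1 := by omega
  have hp' := Nat.mul_self_le_mul_self hm
  omega

/-- On the promise `κ ≤ p_L(t) + 2` the instance length is polynomial in `t`. [folklore] -/
def instPoly : Polynomial ℕ := 2 * X + 4 + pL

/-- `|x| ≤ instPoly(t)` when `κ ≤ p_L(t) + 2`. [folklore] -/
theorem length_inst_le {t κ : ℕ} (hκ : κ ≤ pL.eval t + 2) : (boolPair (ones t) (ones κ)).length ≤ (instPoly pL).eval t := by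
  rw [length_inst]; simp [instPoly]; omega

end Polys

/-! ### The promise problem and its randomised test -/

section Promise

variable (L : Language Bool) (pL : Polynomial ℕ) (T₀ : ℕ)

/-- **The slice-size promise problem** on inputs `⟨1ᵗ, 1^κ⟩` (`t ≥ T₀`, `κ ≤ p_L(t) + 2`):
yes if `|L_t| ≥ 2^κ`, no if `2|L_t| ≤ 2^κ`. [cite: Hirahara2021, Lemma 4.5 (proof: "distinguish whether |L_t| ≥ 2^k or |L_t| ≤ 2^{k-1}")] -/
def estProblem : PromiseProblem where
  yes := {x | ∃ t κ : ℕ, x = boolPair (ones t) (ones κ) ∧ T₀ ≤ t ∧ κ ≤ pL.eval t + 2 ∧ 2 ^ κ ≤ (languageSlice L t).ncard}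
  no := {x | ∃ t κ : ℕ, x = boolPair (ones t) (ones κ) ∧ T₀ ≤ t ∧ κ ≤ pL.eval t + 2 ∧ 2 * (languageSlice L t).ncard ≤ 2 ^ κ}

variable {L pL T₀}

/-- Reading `t, κ` off a promise instance. [folklore] -/
theorem inst_inj {t κ t' κ' : ℕ} (h : boolPair (ones t) (ones κ) = boolPair (ones t') (ones κ')) : t = t' ∧ κ = κ' := by
  have h1 := boolPair_injective (a₁ := (ones t, ones κ)) (a₂ := (ones t', ones κ')) h
  simp only [Prod.mk.injEq] at h1
  exact ⟨by simpa using congr_arg List.length h1.1, by simpa using congr_arg List.length h1.2⟩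

end Promise

/-- **The slice-size promise problem is in promise-`BPP`** under the hypothesis and `pr-BPP = pr-P`
(the latter only to obtain the heuristic `D₂` of Lemma 3.6 in its generator-free form).
[cite: Hirahara2021, Lemma 4.5 (proof, the algorithm R₂ and "the standard technique")] -/
theorem estProblem_mem_PromiseBPP'
    (hyp : ∃ c : ℕ, distClass coNP {uniformEnsemble, tallyEnsemble} ⊆ Avg1DeltaP fun n => 1 - 1 / (n : ℝ) ^ c)
    (hD : PromiseBPP' ⊆ PromiseP) {L : Language Bool} (hL : L ∈ NP) {pL : Polynomial ℕ}
    (hP : ∀ (t : ℕ) (x : List Bool), x ∈ languageSlice L t → x.length ≤ pL.eval t) :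
    ∃ T₀ : ℕ, estProblem L pL T₀ ∈ PromiseBPP' := by
  obtain ⟨D₀, hD₀, q, hmem, hcorr⟩ := ParamUniform.exists_heuristic_paramUniform hyp hD (gsLang_mem_NP hL pL)
  -- the polynomials (kept opaque)
  obtain ⟨n, hn⟩ : ∃ n : Polynomial ℕ, n = 2 * q.comp (sizePoly pL) := ⟨_, rfl⟩
  obtain ⟨Kp, hKp⟩ : ∃ Kp : Polynomial ℕ, Kp = 2 * n + 1 := ⟨_, rfl⟩
  obtain ⟨Q₁, hQ₁⟩ : ∃ Q₁ : Polynomial ℕ, Q₁ = 2 * q.comp ((sizePoly pL).comp (instPoly pL)) := ⟨_, rfl⟩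
  obtain ⟨Q₂, hQ₂⟩ : ∃ Q₂ : Polynomial ℕ, Q₂ = 2 * (n.comp (instPoly pL) + 1) := ⟨_, rfl⟩
  obtain ⟨T₀, hT₀⟩ := exists_eval_le_two_pow 4 (Q₁ + Q₂)
  have hK : ∀ x : List Bool, (Kp + 1 : Polynomial ℕ).eval x.length = Kp.eval x.length + 1 := fun x => by simp
  refine ⟨T₀, (blockOr (rejLang pL D₀) (blockPoly pL) (Kp + 1))ᶜ,
    compl_mem_P_iff.2 (blockOr_mem_P (rejLang_mem_P pL D₀ hD₀) _ _), (Kp + 1) * blockPoly pL, ?_, ?_⟩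
  · -- yes instances: rejected with probability ≤ K e^{-(t+1)} ≤ 1/4
    rintro x ⟨t, κ, rfl, ht, hκ, hs⟩
    have hset : {y : List Bool | boolPair (boolPair (ones t) (ones κ)) y ∈ (blockOr (rejLang pL D₀) (blockPoly pL) (Kp + 1))ᶜ} =
        {y : List Bool | boolPair (boolPair (ones t) (ones κ)) y ∈ blockOr (rejLang pL D₀) (blockPoly pL) (Kp + 1)}ᶜ := rfl
    rw [hset, uniformProb_compl, eval_mul, hK]
    have hle := uniformProb_blockOr_le_mul (rejLang pL D₀) (blockPoly pL) Kp (boolPair (ones t) (ones κ))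
    have hrej := uniformProb_rej_le (D₀ := D₀) (hP t) hs hmem (ellLen_le_blockPoly pL t κ)
    -- K ≤ Q₂(t), 4 (Q₁ + Q₂)(t) ≤ 2^t, e^{-(t+1)} ≤ 2^{-t}
    have hKle : Kp.eval (boolPair (ones t) (ones κ)).length + 1 ≤ Q₂.eval t := by
      have hmono := LCBounds.eval_mono n (length_inst_le pL hκ)
      rw [hQ₂, hKp]
      simp only [eval_mul, eval_add, eval_one, eval_ofNat, eval_comp]
      omega
    have h2 := hT₀ t ht
    rw [eval_add] at h2
    have hK2 : (4 : ℝ) * (Kp.eval (boolPair (ones t) (ones κ)).length + 1 : ℕ) ≤ 2 ^ t := by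
      have : 4 * (Kp.eval (boolPair (ones t) (ones κ)).length + 1) ≤ 2 ^ t := by omega
      exact_mod_cast this
    have hexp := exp_neg_le_inv_two_pow t
    have hpos : (0 : ℝ) < 2 ^ t := by positivity
    have hprod : ((Kp.eval (boolPair (ones t) (ones κ)).length + 1 : ℕ) : ℝ) *
        uniformProb ((blockPoly pL).eval (boolPair (ones t) (ones κ)).length)
          {z | boolPair (boolPair (ones t) (ones κ)) z ∈ rejLang pL D₀} ≤ 1 / 4 := by
      calc ((Kp.eval (boolPair (ones t) (ones κ)).length + 1 : ℕ) : ℝ) *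
            uniformProb ((blockPoly pL).eval (boolPair (ones t) (ones κ)).length)
              {z | boolPair (boolPair (ones t) (ones κ)) z ∈ rejLang pL D₀}
          ≤ ((Kp.eval (boolPair (ones t) (ones κ)).length + 1 : ℕ) : ℝ) * (1 / 2 ^ t) :=
            mul_le_mul_of_nonneg_left (hrej.trans hexp) (by positivity)
        _ ≤ 1 / 4 := by
            rw [mul_one_div, div_le_div_iff₀ hpos (by norm_num)]
            linarith
    linarith
  · -- no instances: rejected with probability ≥ 3/4
    rintro x ⟨t, κ, rfl, ht, hκ, hs⟩
    have hset : {y : List Bool | boolPair (boolPair (ones t) (ones κ)) y ∉ (blockOr (rejLang pL D₀) (blockPoly pL) (Kp + 1))ᶜ} =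
        {y : List Bool | boolPair (boolPair (ones t) (ones κ)) y ∈ blockOr (rejLang pL D₀) (blockPoly pL) (Kp + 1)} :=
      Set.ext fun y => Iff.intro (fun h => by by_contra h'; exact h h') (fun h h' => h' h)
    rw [hset, eval_mul, hK]
    have h34 := uniformProb_blockOr_ge_34 (rejLang pL D₀) (blockPoly pL) (boolPair (ones t) (ones κ)) n ?_
    · rw [← hKp] at h34
      linarith
    -- the per-block rejection probability is ≥ 1/(n(|x|)+1)
    obtain ⟨hq1, hq⟩ := hcorr (ellLen pL t κ) (Nat.pair t κ)
    have hrej := uniformProb_rej_ge (D₀ := D₀) (q := ((q.eval (ellLen pL t κ + Nat.pair t κ) : ℕ) : ℝ)) (hP t) hs hq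
      (ellLen_le_blockPoly pL t κ)
    -- `e^{-(t+1)} ≤ 1/(2 q(ℓ+m))` and `n(|x|) + 1 ≥ 2 q(ℓ+m)`
    have hqle : q.eval (ellLen pL t κ + Nat.pair t κ) ≤ q.eval ((sizePoly pL).eval (boolPair (ones t) (ones κ)).length) :=
      LCBounds.eval_mono q (size_le_sizePoly pL t κ)
    have hn1 : 2 * q.eval (ellLen pL t κ + Nat.pair t κ) ≤ n.eval (boolPair (ones t) (ones κ)).length + 1 := by
      rw [hn]; simp only [eval_mul, eval_ofNat, eval_comp]; omega
    have hQ1 : 2 * q.eval (ellLen pL t κ + Nat.pair t κ) ≤ Q₁.eval t := by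
      have h' := LCBounds.eval_mono (sizePoly pL) (length_inst_le pL hκ)
      have h'' := LCBounds.eval_mono q h'
      rw [hQ₁]; simp only [eval_mul, eval_ofNat, eval_comp]; omega
    have h2 := hT₀ t ht
    rw [eval_add] at h2
    have hq2 : (2 : ℝ) * (q.eval (ellLen pL t κ + Nat.pair t κ) : ℕ) ≤ 2 ^ t := by
      have : 2 * q.eval (ellLen pL t κ + Nat.pair t κ) ≤ 2 ^ t := by omega
      exact_mod_cast this
    have hqpos : (0 : ℝ) < (q.eval (ellLen pL t κ + Nat.pair t κ) : ℕ) := by exact_mod_cast hq1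
    have hexp : exp (-((t : ℝ) + 1)) ≤ 1 / (2 * ((q.eval (ellLen pL t κ + Nat.pair t κ) : ℕ) : ℝ)) :=
      (exp_neg_le_inv_two_pow t).trans (one_div_le_one_div_of_le (by positivity) hq2)
    have hhalf : 1 / (2 * ((q.eval (ellLen pL t κ + Nat.pair t κ) : ℕ) : ℝ)) ≤
        uniformProb ((blockPoly pL).eval (boolPair (ones t) (ones κ)).length)
          {z | boolPair (boolPair (ones t) (ones κ)) z ∈ rejLang pL D₀} := by
      have : 1 / ((q.eval (ellLen pL t κ + Nat.pair t κ) : ℕ) : ℝ) - 1 / (2 * ((q.eval (ellLen pL t κ + Nat.pair t κ) : ℕ) : ℝ)) =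
          1 / (2 * ((q.eval (ellLen pL t κ + Nat.pair t κ) : ℕ) : ℝ)) := by
        field_simp; ring
      linarith
    refine le_trans ?_ hhalf
    have hn1' : (2 : ℝ) * (q.eval (ellLen pL t κ + Nat.pair t κ) : ℕ) ≤ ((n.eval (boolPair (ones t) (ones κ)).length : ℕ) : ℝ) + 1 := by
      exact_mod_cast hn1
    exact one_div_le_one_div_of_le (by positivity) hn1'

/-- **The slice-size test in `P`**: under the hypothesis and `pr-BPP = pr-P` there are `T₀` and a
language `S ∈ P` with `⟨1ᵗ, 1^κ⟩ ∈ S` whenever `|L_t| ≥ 2^κ` and `⟨1ᵗ, 1^κ⟩ ∉ S` whenever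
`2|L_t| ≤ 2^κ`, for all `t ≥ T₀` and `κ ≤ p_L(t) + 2`. [cite: Hirahara2021, Lemma 4.5 (proof: "by using Lemma 3.4 again, we obtain a polynomial-time algorithm")] -/
theorem exists_sliceTest
    (hyp : ∃ c : ℕ, distClass coNP {uniformEnsemble, tallyEnsemble} ⊆ Avg1DeltaP fun n => 1 - 1 / (n : ℝ) ^ c)
    (hD : PromiseBPP' ⊆ PromiseP) {L : Language Bool} (hL : L ∈ NP) {pL : Polynomial ℕ}
    (hP : ∀ (t : ℕ) (x : List Bool), x ∈ languageSlice L t → x.length ≤ pL.eval t) :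
    ∃ T₀ : ℕ, ∃ S ∈ Classes.P, ∀ t κ : ℕ, T₀ ≤ t → κ ≤ pL.eval t + 2 →
      (2 ^ κ ≤ (languageSlice L t).ncard → boolPair (ones t) (ones κ) ∈ S) ∧
      (2 * (languageSlice L t).ncard ≤ 2 ^ κ → boolPair (ones t) (ones κ) ∉ S) := by
  obtain ⟨T₀, hPi⟩ := estProblem_mem_PromiseBPP' hyp hD hL hP
  obtain ⟨S, hS, hyes, hno⟩ := hD hPi
  exact ⟨T₀, S, hS, fun t κ ht hκ => ⟨fun hs => hyes ⟨t, κ, rfl, ht, hκ, hs⟩, fun hs => hno ⟨t, κ, rfl, ht, hκ, hs⟩⟩⟩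

end SLB

end Literature.Computability.MetaComplexity

/-! ## Part 3 — the log-size estimator -/

namespace Literature.Computability.MetaComplexity

open _root_.Computability Polynomial Complexity Complexity.Classes Complexity.Nondeterministic
  Complexity.Brick Complexity.Plumb Complexity.HashBricks Finset

namespace SLB

open scoped Classical

/-! ### The size of a slice -/

/-- A slice of strings of length `≤ P` has fewer than `2^{P+1}` members (the padded members are
nonzero vectors of length `P + 1`). [folklore] -/
theorem ncard_slice_lt {L : Language Bool} {P t : ℕ} (hP : ∀ x ∈ languageSlice L t, x.length ≤ P) :
    (languageSlice L t).ncard < 2 ^ (P + 1) := by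
  rw [← card_sliceVec hP]
  have hzero : List.Vector.replicate (P + 1) false ∉ sliceVec L P t := by
    intro h
    obtain ⟨x, -, -, hx⟩ := (mem_sliceVec_iff _).1 h
    have hx' : List.replicate (P + 1) false = pad P x := hx
    have hmem : true ∈ List.replicate (P + 1) false := by
      rw [hx', pad]; simp
    simp at hmem
  have hss : sliceVec L P t ⊂ (univ : Finset (List.Vector Bool (P + 1))) :=
    Finset.ssubset_iff_subset_ne.2 ⟨subset_univ (sliceVec L P t), fun h => hzero (h ▸ mem_univ _)⟩
  have hlt := card_lt_card hss
  rwa [card_univ, card_vector, Fintype.card_bool] at hlt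

/-! ### The estimator loop -/

section Loop

variable (pL : Polynomial ℕ) (sTest : List Bool → List Bool)

/-- The piece of round `κ` on the argument `⟨x, 1^κ⟩`, `x = ⟨1ᵗ, 1^{p_L(t)+3}⟩`:
`⟨S ⟨1ᵗ, 1^κ⟩, 1^{κ+1}⟩` (the successor clipped by `|x|` for the growth bookkeeping). [folklore] -/
def pieceE : List Bool → List Bool :=
  fanoutFn (sTest ∘ fanoutFn (fstF ∘ fstF) sndF) (List.cons true ∘ takeFn ∘ fanoutFn fstF sndF)

/-- The update `⟨acc, ⟨[b], s⟩⟩ ↦ if b then s else acc`. [folklore] -/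
def opE : List Bool → List Bool := iteFn (isTrue1Fn ∘ fstF ∘ sndF) (sndF ∘ sndF) fstF

/-- The context `⟨1ᵗ, 1^{p_L(t)+3}⟩` read off the input `1ᵗ`. [folklore] -/
def ctxE : List Bool → List Bool := fanoutFn onesFn (polyFn (pL + 3) ∘ onesFn)

/-- **The estimator** `1ᵗ ↦ 1^{κ*}`: fold the pieces of rounds `κ = 0, …, p_L(t)+2`. [cite: Hirahara2021, Lemma 4.5 (proof: "compute the maximum k*")] -/
def estF : List Bool → List Bool := runFold opE (pieceE sTest) (ctxE pL) (polyFn (pL + 3) ∘ onesFn)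

variable {pL sTest}

/-- Value of the update on a well-formed argument. [folklore] -/
theorem opE_apply (acc s : List Bool) (b : Bool) : opE (boolPair acc (boolPair [b] s)) = if b then s else acc := by
  unfold opE
  rw [iteFn_apply (b := b) (by
    rw [Function.comp_apply, Function.comp_apply, sndF_boolPair, fstF_boolPair, isTrue1Fn_apply]; cases b <;> simp)]
  cases b <;> simp

/-- Growth of the update: `|opE w| ≤ |fstF w| + |sndF w|`. [folklore] -/
theorem length_opE_le (w : List Bool) : (opE w).length ≤ (fstF w).length + (X : Polynomial ℕ).eval (sndF w).length := by
  obtain ⟨b, hb⟩ := oneBit_isTrue1Fn (fstF (sndF w))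
  unfold opE
  rw [iteFn_apply (b := b) (by simpa using hb), eval_X]
  have h := length_fstF_sndF_le (sndF w)
  cases b
  · simp
  · simp only [if_true, Function.comp_apply]; omega

/-- Value of the piece of round `κ ≤ |x|`. [folklore] -/
theorem pieceE_apply {R : Language Bool} (hs : ∀ v, sTest v = [R.boolIndicator v]) (t N κ : ℕ)
    (hκ : κ ≤ (boolPair (ones t) (ones N)).length) :
    pieceE sTest (boolPair (boolPair (ones t) (ones N)) (ones κ)) =
      boolPair [R.boolIndicator (boolPair (ones t) (ones κ))] (ones (κ + 1)) := by
  simp only [pieceE, fanoutFn_apply, Function.comp_apply, fstF_boolPair, sndF_boolPair, hs, takeFn_boolPair]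
  rw [List.take_of_length_le (by simpa using hκ)]
  simp [ones, List.replicate_succ]

/-- Growth of the piece: `|pieceE z| ≤ |fstF z| + 5` for a one-bit test. [folklore] -/
theorem length_pieceE_le (hs1 : OneBit sTest) (z : List Bool) :
    (pieceE sTest z).length ≤ (X + 5 : Polynomial ℕ).eval (fstF z).length := by
  obtain ⟨b, hb⟩ := hs1 (boolPair (fstF (fstF z)) (sndF z))
  simp only [pieceE, fanoutFn_apply, Function.comp_apply, hb, length_boolPair, List.length_cons, takeFn_boolPair,
    List.length_take, eval_add, eval_X, eval_ofNat, List.length_nil]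
  omega

/-- **The estimator is in `FP`.** [cite: AroraBarakCC2009, §1.3] -/
theorem estF_mem_FP (hs : sTest ∈ FP) (hs1 : OneBit sTest) : estF pL sTest ∈ FP :=
  runFold_mem_FP (iteFn_mem_FP (comp_mem_FP isTrue1Fn_mem_FP (comp_mem_FP fstF_mem_FP sndF_mem_FP))
      (comp_mem_FP sndF_mem_FP sndF_mem_FP) fstF_mem_FP)
    X length_opE_le
    (fanoutFn_mem_FP (comp_mem_FP hs (fanoutFn_mem_FP (comp_mem_FP fstF_mem_FP fstF_mem_FP) sndF_mem_FP))
      (comp_mem_FP (cons_mem_FP true) (comp_mem_FP takeFn_mem_FP (fanoutFn_mem_FP fstF_mem_FP sndF_mem_FP))))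
    (X + 5) (length_pieceE_le hs1)
    (fanoutFn_mem_FP onesFn_mem_FP (comp_mem_FP (polyFn_mem_FP _) onesFn_mem_FP))
    (comp_mem_FP (polyFn_mem_FP _) onesFn_mem_FP)

/-! ### The model of the loop -/

variable {R : Language Bool} (hs : ∀ v, sTest v = [R.boolIndicator v]) (t N : ℕ)
include hs

/-- One round of the fold on the context `x = ⟨1ᵗ, 1^N⟩` (round `κ ≤ |x|`). [folklore] -/
theorem foldAcc_step (i k : ℕ) (acc : List Bool) (hi : i ≤ (boolPair (ones t) (ones N)).length) :
    foldAcc opE (pieceE sTest) (boolPair (ones t) (ones N)) i (k + 1) acc =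
      foldAcc opE (pieceE sTest) (boolPair (ones t) (ones N)) (i + 1) k
        (if boolPair (ones t) (ones i) ∈ R then ones (i + 1) else acc) := by
  rw [foldAcc_succ, pieceE_apply hs t N i hi, opE_apply]
  by_cases h : boolPair (ones t) (ones i) ∈ R
  · rw [(Set.mem_iff_boolIndicator _ _).1 h, if_pos rfl, if_pos h]
  · rw [(Set.notMem_iff_boolIndicator _ _).1 h, if_neg h]; rfl

/-- **The loop invariant**: started at round `i` with an accumulator of length `≤ i`, the fold over
rounds `i, …, i+k-1` does not shorten the accumulator, ends with the accumulator or with `1^{j+1}` for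
an accepted round `j` in range, and is at least `j + 1` long for every accepted round `j` in range.
[folklore] -/
theorem foldAcc_spec : ∀ (k i : ℕ) (acc : List Bool), i + k ≤ (boolPair (ones t) (ones N)).length → acc.length ≤ i →
    acc.length ≤ (foldAcc opE (pieceE sTest) (boolPair (ones t) (ones N)) i k acc).length ∧
      ((foldAcc opE (pieceE sTest) (boolPair (ones t) (ones N)) i k acc = acc) ∨
        ∃ j, i ≤ j ∧ j < i + k ∧ boolPair (ones t) (ones j) ∈ R ∧
          foldAcc opE (pieceE sTest) (boolPair (ones t) (ones N)) i k acc = ones (j + 1)) ∧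
      ∀ j, i ≤ j → j < i + k → boolPair (ones t) (ones j) ∈ R →
        j + 1 ≤ (foldAcc opE (pieceE sTest) (boolPair (ones t) (ones N)) i k acc).length
  | 0, i, acc, _, _ => ⟨by simp, Or.inl (by simp), fun j h1 h2 _ => by omega⟩
  | k + 1, i, acc, hik, hacc => by
    rw [foldAcc_step hs t N i k acc (by omega)]
    set acc' := (if boolPair (ones t) (ones i) ∈ R then ones (i + 1) else acc) with hacc'
    have hlen' : acc'.length ≤ i + 1 := by
      rw [hacc']
      split_ifs
      · simp
      · omega
    have hle : acc.length ≤ acc'.length := by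
      rw [hacc']
      split_ifs
      · simp only [ParamUniform.length_ones]; omega
      · exact le_rfl
    obtain ⟨h1, h2, h3⟩ := foldAcc_spec k (i + 1) acc' (by omega) hlen'
    refine ⟨hle.trans h1, ?_, fun j hij hj hR => ?_⟩
    · rcases h2 with h2 | ⟨j, hj1, hj2, hjR, hres⟩
      · rw [h2, hacc']
        by_cases hR : boolPair (ones t) (ones i) ∈ R
        · exact Or.inr ⟨i, le_rfl, by omega, hR, by rw [if_pos hR]⟩
        · exact Or.inl (by rw [if_neg hR])
      · exact Or.inr ⟨j, by omega, by omega, hjR, hres⟩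
    · rcases Nat.eq_or_lt_of_le hij with rfl | hlt
      · refine le_trans ?_ h1
        rw [hacc', if_pos hR]; simp
      · exact h3 j hlt (by omega) hR

omit hs in
/-- **Value of the estimator on `1ᵗ`**: the fold over the rounds `0, …, p_L(t)+2` from the empty
accumulator. [folklore] -/
theorem estF_unary (t : ℕ) :
    estF pL sTest (unaryEncodeNat t) =
      foldAcc opE (pieceE sTest) (boolPair (ones t) (ones (pL.eval t + 3))) 0 (pL.eval t + 3) [] := by
  have hones : onesFn (unaryEncodeNat t) = ones t := by
    simp [onesFn, ParamUniform.unaryEncodeNat_eq_ones]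
  have hctx : ctxE pL (unaryEncodeNat t) = boolPair (ones t) (ones (pL.eval t + 3)) := by
    rw [ctxE, fanoutFn_apply, Function.comp_apply, hones, polyFn_apply, ParamUniform.length_ones, eval_add]
    simp
  have hcnt : (polyFn (pL + 3) ∘ onesFn) (unaryEncodeNat t) = ones (pL.eval t + 3) := by
    rw [Function.comp_apply, hones, polyFn_apply, ParamUniform.length_ones, eval_add]
    simp
  unfold estF
  rw [runFold_apply _ _ _ _ (by rw [hctx, hcnt]; simp [length_boolPair]), hctx, hcnt, ParamUniform.length_ones]

omit hs in
/-- **The estimate is sandwiched** once the test is correct on the promise: if, for all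
`κ ≤ p_L(t) + 2`, `S` accepts `⟨1ᵗ, 1^κ⟩` when `|L_t| ≥ 2^κ` and rejects when `2|L_t| ≤ 2^κ`, and
`L_t ⊆ {0,1}^{≤ p_L(t)}`, then `|L_t| ≤ 2^{κ*}` and `κ* ≤ log₂ |L_t| + 3` for `κ* = |estF(1ᵗ)|`.
[cite: Hirahara2021, Lemma 4.5 (proof, last paragraph: "2^{k*+1} ≥ |L_t| … k* ≤ log |L_t|")] -/
theorem estF_spec (hs : ∀ v, sTest v = [R.boolIndicator v]) {L : Language Bool} {t : ℕ}
    (hP : ∀ x ∈ languageSlice L t, x.length ≤ pL.eval t)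
    (hS : ∀ κ, κ ≤ pL.eval t + 2 →
      (2 ^ κ ≤ (languageSlice L t).ncard → boolPair (ones t) (ones κ) ∈ R) ∧
      (2 * (languageSlice L t).ncard ≤ 2 ^ κ → boolPair (ones t) (ones κ) ∉ R)) :
    (languageSlice L t).ncard ≤ 2 ^ (estF pL sTest (unaryEncodeNat t)).length ∧
      (estF pL sTest (unaryEncodeNat t)).length ≤ Nat.log 2 (languageSlice L t).ncard + 3 := by
  set s := (languageSlice L t).ncard with hsdef
  set P := pL.eval t with hPdef
  have hslt : s < 2 ^ (P + 1) := ncard_slice_lt hP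
  obtain ⟨-, hshape, hlow⟩ := foldAcc_spec hs t (P + 3) (P + 3) 0 [] (by simp [length_boolPair]) (by simp)
  rw [estF_unary]
  simp only [zero_add] at hshape hlow
  constructor
  · -- `|L_t| ≤ 2^{κ*}`: the round `k₀ = log₂ s` is accepted
    rcases Nat.eq_zero_or_pos s with hs0 | hs0
    · rw [hs0]; exact Nat.zero_le _
    have hk₀P : Nat.log 2 s ≤ P := Nat.le_of_lt_succ ((Nat.log_lt_iff_lt_pow one_lt_two hs0.ne').2 hslt)
    have hacc : boolPair (ones t) (ones (Nat.log 2 s)) ∈ R := (hS _ (by omega)).1 (Nat.pow_log_le_self 2 hs0.ne')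
    have hlen := hlow (Nat.log 2 s) (Nat.zero_le _) (by omega) hacc
    exact (Nat.lt_pow_succ_log_self one_lt_two s).le.trans (Nat.pow_le_pow_right two_pos hlen)
  · -- `κ* ≤ log₂ |L_t| + 3`: the result is `ε` or `1^{j+1}` for an accepted, hence not rejected, `j`
    rcases hshape with h0 | ⟨j, -, hj, hjR, hres⟩
    · rw [h0]; simp
    · rw [hres, ParamUniform.length_ones]
      have hnrej : ¬ (2 * s ≤ 2 ^ j) := fun h => (hS j (by omega)).2 h hjR
      push Not at hnrej
      have h2j : 1 ≤ 2 ^ j := Nat.one_le_two_pow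
      rcases Nat.eq_zero_or_pos s with hs0 | hs0
      · omega
      have hlt : 2 ^ j < 2 ^ (Nat.log 2 s + 2) := by
        have := Nat.lt_pow_succ_log_self one_lt_two s
        rw [pow_succ, pow_succ]; rw [pow_succ] at this; omega
      have := (Nat.pow_lt_pow_iff_right one_lt_two).1 hlt
      omega

end Loop

/-! ### Lemma 4.5 -/

/-- **Hirahara 2021, Lemma 4.5** (inline form, hypothesis `h45` of
`LCAssembly.Hirahara2021_languageCompression_of_lemmas`): if `coNP × {U, T} ⊆ Avg¹_{1-n^{-c}}P` and
`pr-BPP = pr-P`, then for every `NP` ensemble `L = {L_t}` there is an `FP` function `κ` on `1ᵗ` with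
`|L_t| ≤ 2^{|κ(1ᵗ)|}` and `|κ(1ᵗ)| ≤ log |L_t| + 3` for all large `t`. [cite: Hirahara2021, Lemma 4.5] -/
theorem exists_logSizeEstimator
    (hyp : ∃ c : ℕ, distClass coNP {uniformEnsemble, tallyEnsemble} ⊆ Avg1DeltaP fun n => 1 - 1 / (n : ℝ) ^ c)
    (hD : PromiseBPP' ⊆ PromiseP) {L : Language Bool} (hL : L ∈ NP) (hens : IsLanguageEnsemble L) :
    ∃ κU : List Bool → List Bool, κU ∈ FP ∧ ∃ t₁ : ℕ, ∀ t : ℕ, t₁ ≤ t →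
      (languageSlice L t).ncard ≤ 2 ^ (κU (unaryEncodeNat t)).length ∧
        (κU (unaryEncodeNat t)).length ≤ Nat.log 2 (languageSlice L t).ncard + 3 := by
  obtain ⟨pL, hpL⟩ := hens
  obtain ⟨T₀, S, hSP, hS⟩ := exists_sliceTest hyp hD hL hpL
  obtain ⟨rr, Mach, hMach⟩ := polyTimeDecidable_iff.1 (mem_P_iff_holds.1 hSP)
  have hdec : (fun z : List Bool => encodeBool (S.boolIndicator z)) ∈ FP := ⟨rr, Mach, fun z => hMach z⟩
  refine ⟨estF pL fun z => encodeBool (S.boolIndicator z), estF_mem_FP hdec (fun z => ⟨_, rfl⟩), T₀, fun t ht => ?_⟩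
  exact estF_spec (R := S) (fun v => rfl) (hpL t) fun κ hκ => hS t κ ht hκ

end SLB

end Literature.Computability.MetaComplexity
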